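import Summits.QuantumFields.BalabanUV.T4Continuum.Support.AveragingDeficitFermat
import Summits.QuantumFields.BalabanUV.T4Continuum.Support.NE3FlatHessianCurl
import Summits.QuantumFields.BalabanUV.T4Continuum.Support.NE3EnergyHessBilin
import Summits.QuantumFields.BalabanUV.T4Continuum.Support.NE3TangentCovariantTower
import Summits.QuantumFields.BalabanUV.T4Continuum.Support.NE3SmoothRightInverseFlat
import Summits.QuantumFields.BalabanUV.T4Continuum.Support.NE3FramePotBoundComplex
import Summits.QuantumFields.BalabanUV.T4Continuum.Support.NE3SmoothLiftCurl
import HarnessLib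

/-!
# NE7FlatSkewSliceSolvable — row NE7 (node U5), the (A)-bill's END at the trivial flat datum: THE SLICE SOLVER LETTER `G♭` ON THE SKEW SLICE
# IS SATISFIABLE ON EVERY FINITE TORUS — for every period `P ≥ 1`, `L ≥ 1`, `j`, SOME constant `K_G(P, L, j, d, n)` exists (kernel certificate of
# the NE7 pricing desk's «per lattice» belief, PRICING-NE7 v60 §434 (d)); the `k`-UNIFORM constant is NOT touched

Lineage `b2b-balaban-t4-ne7-p2` (CRUX PROVER NE7 #2, co-owner of row NE7), generation 83; sequel of file 135 `NE7FlatSkewSlice` (p378872: the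
desk's E-62-1 repair R1 + R1b — F44's bootstrap with `G♭` asked on SKEW periodic tangent fields).  Over the torus chart `AveragingDeficitTorusChart`
(`TDir`, `extDir ∕ resDir`, `redN`), the flat Hessian core `NE3FlatHessianCurl.hess_flatCfg_ge_sum`, the Hessian kit `NE3EnergyHessBilin ∕
NE3EnergyHessTwoTerm`, `NE3TangentCovariantTower.dirIter_flat` and the linearity of B7's contour averages.
WHY.  After R1 + R1b the END's slice solver letter reads, for a constant `K_G`: `hG′ : ∀ X skew, P-periodic, dirIter L j 1 X = 0, ∀ g ≥ 0,
(∀ Y skew periodic, dirIter L j 1 Y = 0 → |hess 1 X Y (perWin d P)| ≤ g·‖Y‖_{ℓ¹(periodBox P)}) → ∀ z μ ≠ ν, ‖curl 1 X (z; μ, ν)‖ ≤ K_G·g`.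
The desk (§434 (d)) records the satisfiability of `hG′` on each finite torus as «a desk BELIEF by finite-dimensionality, not a certificate»; the
content of the (A)-bill's XL(c) driver is that `K_G = K·L^(k+1)` with `K` INDEPENDENT of `k`.  THIS FILE supplies the certificate of the belief — and
ONLY that: **`exists_sliceSolver_flat_skew`**: for every `d`, nonempty `n`, `L ≥ 1`, `j`, `P ≥ 1` there is `K_G ≥ 0` with `hG′`.  So the repaired END
(F54 v3) has a CONSISTENT `G♭` hypothesis on every lattice; its `k`-uniformity remains unprinted ∕ unproved.
HOW ([folklore]).  §1 two finite-dimensional lemmas (Mathlib-only): **`norm_le_mul_seminorm_of_definite`** — a continuous definite seminorm on a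
finite-dimensional real normed space dominates the norm (minimum on the unit sphere); **`exists_split_norm_le_mul_seminorm`** — on a subspace `V`,
every `x ∈ V` splits as `z + w`, `z ∈ V ∩ ker q`, `‖w‖ ≤ K·q x` (a linear complement of the kernel inside `V`).  §2 the flat curl of periodic fields on
the torus chart: linearity of `extDir`, `curl 1`, `dirIter L j 1` (`dirIter_flat_add ∕ _smul`), periodicity of `curl 1 X` along the period lattice,
**`norm_curlAt_flat_le_sum_perWin`** (`‖curl 1 X (z;μ,ν)‖ ≤ Σ_{p ∈ perWin d P} ‖curl 1 X p‖`), the window seminorm `curlSeminorm` on `TDir d n P`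
(continuous), the subspace `skewTangent`.  §3: given `X`, split `resDir X = ζ + w` by §1 with `q = curlSeminorm` inside `skewTangent`; test the
premise with `Y := X − extDir ζ` (skew periodic tangent; `curl 1 (extDir ζ) = 0` on the window): `(1∕N)·Σ_W ‖curl 1 X‖² ≤ hess 1 X X = hess 1 X Y
≤ g·‖Y‖₁ ≤ g·#box·d·K·Σ_W ‖curl 1 X‖`, whence by Cauchy–Schwarz `Σ_W ‖curl 1 X‖ ≤ N·#W·#box·d·K·g`.
HONEST FRAMING (page 1): [folklore] finite-dimensional linear algebra + the tree's flat Hessian identity; the constant `K_G` is NON-EXPLICIT (a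
minimum over a sphere) and depends on `(P, L, j, d, n)` — it says NOTHING about the `k`-uniform constant the END consumes (XL(c) critical, PRICING-NE7
v62); nothing of Bałaban's asserted; NOT (APE), NOT ONE-STEP, NOT NE7; spine 0∕9; finite T⁴ rung (B)+1 — NOT infinite volume, NOT mass gap, NOT Clay.
Continuum YM on T⁴ ⇐ BetaPertH ∧ nine spine estimates (0/9 proved); BetaPertH ⇐ (D1) ∧ (D4) ∧ CAP+tail; G-an2-4 gates asym, D1 and NE2/3/4.
-/

set_option autoImplicit false

open scoped BigOperators Matrix Matrix.Norms.L2Operator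
open NormedSpace Finset

namespace Summit.QuantumFields.BalabanUV.T4Continuum.NE7FlatSkewSliceSolvable

/-! ## §1 Two finite-dimensional lemmas: a definite seminorm dominates the norm; bounded splitting modulo the kernel of a seminorm -/

section FiniteDimensional

variable {W : Type*} [NormedAddCommGroup W] [NormedSpace ℝ W] [FiniteDimensional ℝ W]

/-- **A continuous DEFINITE seminorm on a finite-dimensional real normed space dominates the norm**: `‖w‖ ≤ K·q w` for one `K ≥ 0`
(`K⁻¹` = the minimum of `q` on the unit sphere, attained by compactness). [folklore] -/
theorem norm_le_mul_seminorm_of_definite (q : Seminorm ℝ W) (hqc : Continuous q) (hq : ∀ w, q w = 0 → w = 0) :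
    ∃ K : ℝ, 0 ≤ K ∧ ∀ w, ‖w‖ ≤ K * q w := by
  by_cases hW : ∃ w : W, w ≠ 0
  · obtain ⟨w₁, hw₁⟩ := hW
    have hS : IsCompact (Metric.sphere (0 : W) 1) := isCompact_sphere 0 1
    have hne : (Metric.sphere (0 : W) 1).Nonempty := by
      refine ⟨‖w₁‖⁻¹ • w₁, ?_⟩
      rw [mem_sphere_zero_iff_norm, norm_smul, norm_inv, norm_norm, inv_mul_cancel₀ (norm_ne_zero_iff.mpr hw₁)]
    obtain ⟨w₀, hw₀S, hmin⟩ := hS.exists_isMinOn hne hqc.continuousOn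
    have hw₀ : ‖w₀‖ = 1 := mem_sphere_zero_iff_norm.mp hw₀S
    have hm₀ : 0 < q w₀ := by
      refine lt_of_le_of_ne (apply_nonneg q w₀) fun h => ?_
      rw [hq w₀ h.symm, norm_zero] at hw₀
      exact zero_ne_one hw₀
    refine ⟨(q w₀)⁻¹, by positivity, fun w => ?_⟩
    by_cases hw : w = 0
    · simp [hw]
    · have hn : ‖w‖ ≠ 0 := norm_ne_zero_iff.mpr hw
      have hu : ‖w‖⁻¹ • w ∈ Metric.sphere (0 : W) 1 := by
        rw [mem_sphere_zero_iff_norm, norm_smul, norm_inv, norm_norm, inv_mul_cancel₀ hn]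
      have h1 : q w₀ ≤ q (‖w‖⁻¹ • w) := hmin hu
      rw [map_smul_eq_mul, norm_inv, norm_norm] at h1
      rw [le_inv_mul_iff₀ (norm_pos_iff.mpr hw)] at h1
      calc ‖w‖ = (q w₀)⁻¹ * (q w₀ * ‖w‖) := by field_simp
        _ ≤ (q w₀)⁻¹ * q w := by gcongr; linarith [h1, mul_comm (q w₀) ‖w‖]
  · push Not at hW
    exact ⟨0, le_rfl, fun w => by simp [hW w]⟩

variable {T : Type*} [NormedAddCommGroup T] [NormedSpace ℝ T]

/-- The kernel of a seminorm inside a subspace `V`, as a subspace. [folklore] -/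
def kerIn (V : Submodule ℝ T) (q : Seminorm ℝ T) : Submodule ℝ T where
  carrier := {x | x ∈ V ∧ q x = 0}
  add_mem' := by
    rintro a b ⟨ha, hqa⟩ ⟨hb, hqb⟩
    refine ⟨V.add_mem ha hb, le_antisymm ?_ (apply_nonneg q _)⟩
    calc q (a + b) ≤ q a + q b := map_add_le_add q a b
      _ = 0 := by rw [hqa, hqb, add_zero]
  zero_mem' := ⟨V.zero_mem, map_zero q⟩
  smul_mem' := by
    rintro c x ⟨hx, hqx⟩
    exact ⟨V.smul_mem c hx, by rw [map_smul_eq_mul, hqx, mul_zero]⟩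

/-- **BOUNDED SPLITTING MODULO THE KERNEL OF A SEMINORM**: on a subspace `V` of a finite-dimensional real normed space, for a continuous seminorm
`q`, there is ONE `K ≥ 0` such that every `x ∈ V` is `z + (x − z)` with `z ∈ V`, `q z = 0` and `‖x − z‖ ≤ K·q x` (a linear complement of
`V ∩ ker q` inside `V`, on which `q` is definite). [folklore] -/
theorem exists_split_norm_le_mul_seminorm [FiniteDimensional ℝ T] (V : Submodule ℝ T) (q : Seminorm ℝ T) (hqc : Continuous q) :
    ∃ K : ℝ, 0 ≤ K ∧ ∀ x ∈ V, ∃ z ∈ V, q z = 0 ∧ ‖x - z‖ ≤ K * q x := by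
  let ZV : Submodule ℝ V := (kerIn V q).comap V.subtype
  obtain ⟨WV, hc⟩ := ZV.exists_isCompl
  let qW : Seminorm ℝ WV := q.comp (V.subtype.comp WV.subtype)
  have hqWc : Continuous qW := hqc.comp (continuous_subtype_val.comp continuous_subtype_val)
  have hqW : ∀ w : WV, qW w = 0 → w = 0 := by
    intro w hw
    have hmem : (w : V) ∈ ZV := ⟨(w : V).2, hw⟩
    have hdis := hc.disjoint
    rw [Submodule.disjoint_def] at hdis
    exact Subtype.ext (hdis _ hmem w.2)
  obtain ⟨K, hK0, hK⟩ := norm_le_mul_seminorm_of_definite qW hqWc hqW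
  refine ⟨K, hK0, fun x hx => ?_⟩
  obtain ⟨z, w, hsum, -⟩ := Submodule.existsUnique_add_of_isCompl hc (⟨x, hx⟩ : V)
  have hzZ : (z : V) ∈ ZV := z.2
  have hxz : x - ((z : V) : T) = ((w : V) : T) := by
    have h := congrArg (fun v : V => (v : T)) hsum
    simp only [Submodule.coe_add] at h; rw [← h, add_sub_cancel_left]
  have hqz : q ((z : V) : T) = 0 := hzZ.2
  refine ⟨((z : V) : T), (z : V).2, hqz, ?_⟩
  rw [hxz]
  calc ‖((w : V) : T)‖ = ‖w‖ := rfl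
    _ ≤ K * qW w := hK w
    _ = K * q ((w : V) : T) := rfl
    _ = K * q (x - ((z : V) : T)) := by rw [hxz]
    _ ≤ K * q x := by
        gcongr
        calc q (x - ((z : V) : T)) ≤ q x + q (-((z : V) : T)) := by rw [sub_eq_add_neg]; exact map_add_le_add q _ _
          _ = q x := by rw [map_neg_eq_map, hqz, add_zero]

end FiniteDimensional

/-! ## §2 The flat curl of periodic fields on the torus chart -/

open Literature.MathematicalPhysics.QuantumFieldTheory.Balaban1983to89
open B7Prop1Explicit B7Prop2Explicit UnitaryModel
open T4AveragingDeficitWall hiding Site Plane Plaq Bond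
open T4AveragingDeficitWallBoundary (IsPeriodicCfg periodBox)
open AveragingDeficitPeriodicCounting (IsPeriodicDir curl_add_period)
open MinimalActionLevels (perWin)
open MinimalActionWitness (flatCfg)
open BlockAveragePushDirSplit (flat)
open SmoothRefineNeutral (Tcoarse)
open NE3HessForm (hess hessPlaq hessPlaqAt dcurlAt)
open NE3TangentCovariantTower (dirIter dirIter_flat)
open NE3EnergyHessBilin (hess_add_right curlAt_add curlAt_smul)
open NE3SmoothLiftCurl (curlAt_flat_eq)
open NE3FlatHessianCurl (hess_flatCfg_ge_sum flatCfg_eq_one)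
open AveragingDeficitTorusChart (TDir extDir resDir redN extDir_resDir isPeriodicDir_extDir eq_wrap_add periodic_smul_vec)
open AveragingDeficitFermat (boxVec_redN_mem)

noncomputable section

variable {d : ℕ} {n : Type*} [Fintype n] [DecidableEq n]

/-! ### Periodicity of the flat curl; reduction of a plaquette to the period window -/

/-- The flat background is periodic with every period. [folklore] -/
theorem isPeriodicCfg_flat' (P : ℤ) : IsPeriodicCfg (flat (d := d) (n := n)) P := fun _ _ _ => rfl

/-- At the flat background the dressed curl is antisymmetric in the plane indices. [folklore] -/
theorem curlAt_flat_swap (X : Site d → Fin d → Matrix n n ℂ) (z : Site d) (μ ν : Fin d) :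
    curlAt (flat (d := d) (n := n)) X z ν μ = -curlAt (flat (d := d) (n := n)) X z μ ν := by
  rw [curlAt_flat_eq, curlAt_flat_eq]
  abel

/-- The flat curl of a `P`-periodic field is invariant under the period lattice `P·ℤ^d`. [folklore] -/
theorem curl_flat_add_smul {X : Site d → Fin d → Matrix n n ℂ} {P : ℤ} (hXP : IsPeriodicDir X P) (x k : Site d)
    (π : T4AveragingDeficitWall.Plane d) : curl (flat (d := d) (n := n)) X (x + P • k, π) = curl (flat (d := d) (n := n)) X (x, π) :=
  periodic_smul_vec (f := fun y => curl (flat (d := d) (n := n)) X (y, π))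
    (fun y κ => curl_add_period (isPeriodicCfg_flat' P) hXP y κ π) x k

/-- **Every flat curl value of a `P`-periodic field is one of the window's**: for `μ ≠ ν`,
`‖curl 1 X (z; μ, ν)‖ ≤ Σ_{p ∈ perWin d P} ‖curl 1 X p‖`. [folklore] -/
theorem norm_curlAt_flat_le_sum_perWin {P : ℕ} [NeZero P] {X : Site d → Fin d → Matrix n n ℂ} (hXP : IsPeriodicDir X (P : ℤ))
    (z : Site d) {μ ν : Fin d} (hμν : μ ≠ ν) :
    ‖curlAt (flat (d := d) (n := n)) X z μ ν‖ ≤ ∑ p ∈ perWin d P, ‖curl (flat (d := d) (n := n)) X p‖ := by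
  -- reduce the base point to the period box
  set z₀ : Site d := boxVec P (redN P z) with hz₀
  have hz₀mem : z₀ ∈ periodBox (d := d) P := boxVec_redN_mem P z
  have hred : ∀ π : T4AveragingDeficitWall.Plane d,
      curl (flat (d := d) (n := n)) X (z, π) = curl (flat (d := d) (n := n)) X (z₀, π) := fun π => by
    conv_lhs => rw [eq_wrap_add P z]
    exact curl_flat_add_smul hXP z₀ _ π
  have hle : ∀ π : T4AveragingDeficitWall.Plane d,
      ‖curl (flat (d := d) (n := n)) X (z₀, π)‖ ≤ ∑ p ∈ perWin d P, ‖curl (flat (d := d) (n := n)) X p‖ := fun π =>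
    Finset.single_le_sum (f := fun p => ‖curl (flat (d := d) (n := n)) X p‖) (fun _ _ => norm_nonneg _)
      (Finset.mem_product.mpr ⟨hz₀mem, Finset.mem_univ _⟩)
  rcases lt_or_gt_of_ne hμν with h | h
  · have e : curlAt (flat (d := d) (n := n)) X z μ ν = curl (flat (d := d) (n := n)) X (z, ⟨(μ, ν), h⟩) := rfl
    rw [e, hred]
    exact hle _
  · have e : curlAt (flat (d := d) (n := n)) X z μ ν = -curl (flat (d := d) (n := n)) X (z, ⟨(ν, μ), h⟩) := curlAt_flat_swap X z ν μ
    rw [e, norm_neg, hred]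
    exact hle _

/-! ### The torus chart: linearity of `extDir`, of the flat curl and of the flat linearised averages -/

section Chart

variable (P : ℕ) [NeZero P]

omit [Fintype n] [DecidableEq n] in
/-- `extDir` is additive. [folklore] -/
theorem extDir_add (ψ φ : TDir d n P) : extDir P (ψ + φ) = extDir P ψ + extDir P φ := rfl

omit [Fintype n] [DecidableEq n] in
/-- `extDir` is real-homogeneous. [folklore] -/
theorem extDir_smul (c : ℝ) (ψ : TDir d n P) : extDir P (c • ψ) = c • extDir P ψ := rfl

/-- Bondwise `‖extDir ψ (x, κ)‖ ≤ ‖ψ‖` (sup norm of the chart). [folklore] -/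
theorem norm_extDir_le (ψ : TDir d n P) (x : Site d) (κ : Fin d) : ‖extDir P ψ x κ‖ ≤ ‖ψ‖ :=
  (norm_le_pi_norm (ψ (redN P x)) κ).trans (norm_le_pi_norm ψ _)

/-- `‖extDir ψ‖_{ℓ¹(periodBox P)} ≤ #periodBox·d·‖ψ‖`. [folklore] -/
theorem dirL1_extDir_le (ψ : TDir d n P) :
    dirL1 (extDir P ψ) (periodBox (d := d) P) ≤ ((periodBox (d := d) P).card * d : ℝ) * ‖ψ‖ := by
  unfold dirL1
  calc ∑ x ∈ periodBox (d := d) P, ∑ κ : Fin d, ‖extDir P ψ x κ‖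
      ≤ ∑ x ∈ periodBox (d := d) P, ∑ κ : Fin d, ‖ψ‖ :=
        Finset.sum_le_sum fun x _ => Finset.sum_le_sum fun κ _ => norm_extDir_le P ψ x κ
    _ = ((periodBox (d := d) P).card * d : ℝ) * ‖ψ‖ := by
        rw [Finset.sum_const, Finset.sum_const, Finset.card_univ, Fintype.card_fin, nsmul_eq_mul, nsmul_eq_mul]
        ring

omit [Fintype n] [DecidableEq n] in
/-- A real multiple of a matrix read as a complex multiple. [folklore] -/
theorem real_smul_eq_coe_smul (c : ℝ) (M : Matrix n n ℂ) : c • M = (c : ℂ) • M := by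
  rw [← Complex.coe_algebraMap]
  exact (algebraMap_smul ℂ c M).symm

/-- The `j`-fold flat linearised average is additive (B7's contour averages are linear). [folklore] -/
theorem dirIter_flat_add {L : ℕ} (hL : 1 ≤ L) (j : ℕ) (X Y : Site d → Fin d → Matrix n n ℂ) :
    dirIter L j (flat (d := d) (n := n)) (X + Y) = dirIter L j (flat (d := d) (n := n)) X + dirIter L j (flat (d := d) (n := n)) Y := by
  rw [dirIter_flat hL, dirIter_flat hL, dirIter_flat hL]
  exact NE3SmoothRightInverseFlat.iterate_Tcoarse_add L j X Y

/-- The `j`-fold flat linearised average is real-homogeneous. [folklore] -/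
theorem dirIter_flat_smul {L : ℕ} (hL : 1 ≤ L) (j : ℕ) (c : ℝ) (X : Site d → Fin d → Matrix n n ℂ) :
    dirIter L j (flat (d := d) (n := n)) (c • X) = c • dirIter L j (flat (d := d) (n := n)) X := by
  rw [dirIter_flat hL, dirIter_flat hL]
  have h := NE3FramePotBoundComplex.iterate_Tcoarse_map ((c : ℂ) • (LinearMap.id : Matrix n n ℂ →ₗ[ℂ] Matrix n n ℂ)) L j X
  have e1 : (fun y μ => ((c : ℂ) • (LinearMap.id : Matrix n n ℂ →ₗ[ℂ] Matrix n n ℂ)) (X y μ)) = c • X := by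
    funext y μ; rw [Pi.smul_apply, Pi.smul_apply, real_smul_eq_coe_smul]; rfl
  rw [e1] at h
  rw [h]
  funext z κ
  rw [Pi.smul_apply, Pi.smul_apply, real_smul_eq_coe_smul]; rfl

/-- THE SKEW TANGENT SUBSPACE of the torus chart: parameters whose periodic extension is skew and annihilated by the `j`-fold flat average.
[folklore] -/
def skewTangent (L j : ℕ) (hL : 1 ≤ L) : Submodule ℝ (TDir d n P) where
  carrier := {ψ | IsSkewDir (extDir P ψ) ∧ dirIter L j (flat (d := d) (n := n)) (extDir P ψ) = 0}
  add_mem' := by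
    rintro ψ φ ⟨hψs, hψt⟩ ⟨hφs, hφt⟩
    refine ⟨fun x κ => ?_, ?_⟩
    · rw [extDir_add]
      exact (skewAdjoint (Matrix n n ℂ)).add_mem (hψs x κ) (hφs x κ)
    · rw [extDir_add, dirIter_flat_add hL, hψt, hφt, add_zero]
  zero_mem' := by
    refine ⟨fun x κ => (skewAdjoint (Matrix n n ℂ)).zero_mem, ?_⟩
    have h := dirIter_flat_smul (d := d) (n := n) hL j 0 (extDir P (0 : TDir d n P))
    rw [zero_smul, zero_smul] at h
    exact h
  smul_mem' := by
    rintro c ψ ⟨hψs, hψt⟩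
    refine ⟨fun x κ => ?_, ?_⟩
    · rw [extDir_smul]
      exact skewAdjoint.smul_mem c (hψs x κ)
    · rw [extDir_smul, dirIter_flat_smul hL, hψt, smul_zero]

/-- THE WINDOW CURL SEMINORM on the torus chart: `ψ ↦ Σ_{p ∈ perWin d P} ‖curl 1 (extDir ψ) p‖`. [folklore] -/
def curlSeminorm : Seminorm ℝ (TDir d n P) :=
  Seminorm.of (fun ψ => ∑ p ∈ perWin d P, ‖curl (flat (d := d) (n := n)) (extDir P ψ) p‖)
    (fun ψ φ => by
      rw [← Finset.sum_add_distrib]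
      refine Finset.sum_le_sum fun p _ => ?_
      rw [extDir_add]
      show ‖curlAt _ (extDir P ψ + extDir P φ) _ _ _‖ ≤ _
      rw [curlAt_add]
      exact norm_add_le _ _)
    (fun c ψ => by
      rw [Finset.mul_sum]
      refine Finset.sum_congr rfl fun p _ => ?_
      rw [extDir_smul]
      show ‖curlAt _ (c • extDir P ψ) _ _ _‖ = _
      rw [curlAt_smul, norm_smul]
      rfl)

/-- unfolding. [folklore] -/
theorem curlSeminorm_apply (ψ : TDir d n P) :
    curlSeminorm (d := d) (n := n) P ψ = ∑ p ∈ perWin d P, ‖curl (flat (d := d) (n := n)) (extDir P ψ) p‖ := rfl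

/-- The window curl seminorm is continuous (finitely many bond evaluations). [folklore] -/
theorem continuous_curlSeminorm : Continuous (curlSeminorm (d := d) (n := n) P) := by
  refine continuous_finsetSum _ fun p _ => Continuous.norm ?_
  show Continuous fun ψ : TDir d n P => curlAt (flat (d := d) (n := n)) (extDir P ψ) p.1 p.2.1.1 p.2.1.2
  simp only [curlAt_flat_eq, extDir]
  fun_prop

/-- In the kernel of the window seminorm the flat curl vanishes on the window. [folklore] -/
theorem curl_eq_zero_of_curlSeminorm {ψ : TDir d n P} (h : curlSeminorm (d := d) (n := n) P ψ = 0)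
    {p : T4AveragingDeficitWall.Plaq d} (hp : p ∈ perWin d P) : curl (flat (d := d) (n := n)) (extDir P ψ) p = 0 := by
  exact norm_eq_zero.mp ((Finset.sum_eq_zero_iff_of_nonneg fun _ _ => norm_nonneg _).mp h p hp)

end Chart

/-! ### The flat Hessian against a field with vanishing curl on the window -/

/-- If `curl 1 Z` vanishes on the window `W` then `hess 1 X Z W = 0` (the `dcurlAt` term is traceless, the product term has the factor `curl 1 Z`).
[folklore] -/
theorem hess_flat_eq_zero_of_curl {X Z : Site d → Fin d → Matrix n n ℂ} {W : Finset (T4AveragingDeficitWall.Plaq d)}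
    (hZ : ∀ p ∈ W, curl (flat (d := d) (n := n)) Z p = 0) : hess (flat (d := d) (n := n)) X Z W = 0 := by
  refine Finset.sum_eq_zero fun p hp => ?_
  have h0 : curlAt (flat (d := d) (n := n)) Z p.1 p.2.1.1 p.2.1.2 = 0 := hZ p hp
  rw [hessPlaq, hessPlaqAt, hol_flat, Units.val_one, mul_one, T4TiltOscillation.nReTr_add, NE3EnergyHessTwoTerm.nReTr_dcurlAt, zero_add, h0,
    zero_mul]
  simp [nReTr]

/-! ## §3 THE CERTIFICATE: the skew-slice solver letter holds on every finite torus with SOME constant -/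

/-- **`G♭` ON THE SKEW SLICE IS SATISFIABLE ON EVERY FINITE TORUS.**  For every dimension `d`, nonempty `n`, `L ≥ 1`, `j`, period `P ≥ 1` there is
`K_G ≥ 0` such that: for every SKEW `P`-periodic `X` with `dirIter L j 1 X = 0` and every `g ≥ 0`, if `|hess 1 X Y (perWin d P)| ≤ g·‖Y‖_{ℓ¹(periodBox P)}`
for all skew `P`-periodic `Y` with `dirIter L j 1 Y = 0`, then `‖curl 1 X (z; μ, ν)‖ ≤ K_G·g` for all `z`, `μ ≠ ν` — the hypothesis `hG` of
`NE7FlatSkewSlice.smallField_vary_flat_of_flatLetters_skew` (F54 v3's `G♭`) with `P = L^(k+1)·N`, `j = k + 1`.  `K_G` is NOT explicit and NOT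
claimed `k`-uniform. [folklore] -/
theorem exists_sliceSolver_flat_skew [Nonempty n] {L : ℕ} (hL : 1 ≤ L) (j : ℕ) (P : ℕ) [NeZero P] :
    ∃ KG : ℝ, 0 ≤ KG ∧ ∀ X : Site d → Fin d → Matrix n n ℂ, IsSkewDir X → IsPeriodicDir X (P : ℤ) →
      dirIter L j (flat (d := d) (n := n)) X = 0 → ∀ g : ℝ, 0 ≤ g →
      (∀ Y : Site d → Fin d → Matrix n n ℂ, IsSkewDir Y → IsPeriodicDir Y (P : ℤ) → dirIter L j (flat (d := d) (n := n)) Y = 0 →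
        |hess (flat (d := d) (n := n)) X Y (perWin d P)| ≤ g * dirL1 Y (periodBox (d := d) P)) →
      ∀ (z : Site d) (μ ν : Fin d), μ ≠ ν → ‖curlAt (flat (d := d) (n := n)) X z μ ν‖ ≤ KG * g := by
  classical
  obtain ⟨K, hK0, hK⟩ := exists_split_norm_le_mul_seminorm (skewTangent (d := d) (n := n) P L j hL) (curlSeminorm (d := d) (n := n) P)
    (continuous_curlSeminorm P)
  set B : ℝ := ((periodBox (d := d) P).card * d : ℝ) with hB
  set KG : ℝ := (Fintype.card n : ℝ) * (perWin d P).card * (B * K) with hKG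
  have hB0 : 0 ≤ B := by rw [hB]; positivity
  refine ⟨KG, by rw [hKG]; positivity, ?_⟩
  intro X hXs hXP hXT g hg hsrc z μ ν hμν
  set ψ : TDir d n P := resDir P X
  have hXe : extDir P ψ = X := extDir_resDir P hXP
  have hψV : ψ ∈ skewTangent (d := d) (n := n) P L j hL := by
    show IsSkewDir (extDir P ψ) ∧ dirIter L j (flat (d := d) (n := n)) (extDir P ψ) = 0
    rw [hXe]; exact ⟨hXs, hXT⟩
  obtain ⟨ζ, hζV, hζ0, hζK⟩ := hK ψ hψV
  -- the test field `Y := X − extDir ζ`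
  set Y : Site d → Fin d → Matrix n n ℂ := extDir P (ψ - ζ) with hY
  have hYV : ψ - ζ ∈ skewTangent (d := d) (n := n) P L j hL := Submodule.sub_mem _ hψV hζV
  have hYeq : Y = X + (-(extDir P ζ)) := by rw [hY, ← hXe, ← sub_eq_add_neg]; rfl
  -- `hess 1 X Y = hess 1 X X` (the curl of `extDir ζ` vanishes on the window)
  have hζcurl : ∀ p ∈ perWin d P, curl (flat (d := d) (n := n)) (-(extDir P ζ)) p = 0 := by
    intro p hp
    show curlAt _ (-(extDir P ζ)) _ _ _ = 0
    rw [← neg_one_smul ℝ (extDir P ζ), curlAt_smul]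
    show (-1 : ℝ) • curl (flat (d := d) (n := n)) (extDir P ζ) p = 0
    rw [curl_eq_zero_of_curlSeminorm P hζ0 hp, smul_zero]
  have hhess : hess (flat (d := d) (n := n)) X Y (perWin d P) = hess (flat (d := d) (n := n)) X X (perWin d P) := by
    rw [hYeq, hess_add_right, hess_flat_eq_zero_of_curl hζcurl, add_zero]
  set S : ℝ := ∑ p ∈ perWin d P, ‖curl (flat (d := d) (n := n)) X p‖ with hS
  set S2 : ℝ := ∑ p ∈ perWin d P, ‖curl (flat (d := d) (n := n)) X p‖ ^ 2 with hS2
  have hS0 : 0 ≤ S := Finset.sum_nonneg fun _ _ => norm_nonneg _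
  have hqψ : curlSeminorm (d := d) (n := n) P ψ = S := by rw [curlSeminorm_apply, hXe]
  -- (1∕N)·S2 ≤ hess 1 X X
  have h1 : (Fintype.card n : ℝ)⁻¹ * S2 ≤ hess (flat (d := d) (n := n)) X X (perWin d P) := by
    have h := hess_flatCfg_ge_sum (n := n) hXs (perWin d P)
    rwa [flatCfg_eq_one] at h
  -- hess 1 X X = hess 1 X Y ≤ g·‖Y‖₁ ≤ g·B·‖ψ − ζ‖ ≤ g·B·K·S
  have h2 : hess (flat (d := d) (n := n)) X X (perWin d P) ≤ g * (B * K * S) := by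
    have ha := hsrc Y hYV.1 (isPeriodicDir_extDir P _) hYV.2
    rw [hhess] at ha
    have hb : dirL1 Y (periodBox (d := d) P) ≤ B * ‖ψ - ζ‖ := by rw [hY, hB]; exact dirL1_extDir_le P (ψ - ζ)
    have hc : ‖ψ - ζ‖ ≤ K * S := by rw [← hqψ]; exact hζK
    calc hess (flat (d := d) (n := n)) X X (perWin d P) ≤ |hess (flat (d := d) (n := n)) X X (perWin d P)| := le_abs_self _
      _ ≤ g * dirL1 Y (periodBox (d := d) P) := ha
      _ ≤ g * (B * (K * S)) := by gcongr; exact hb.trans (by gcongr)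
      _ = g * (B * K * S) := by ring
  -- Cauchy–Schwarz: S² ≤ #W·S2
  have h3 : S ^ 2 ≤ (perWin d P).card * S2 := by rw [hS, hS2]; exact sq_sum_le_card_mul_sum_sq
  -- hence S ≤ KG·g
  have hN : (0 : ℝ) < Fintype.card n := by exact_mod_cast Fintype.card_pos
  have h4 : S ^ 2 ≤ KG * g * S := by
    have : S2 ≤ Fintype.card n * (g * (B * K * S)) := by
      have := h1.trans h2
      rwa [inv_mul_le_iff₀ hN] at this
    calc S ^ 2 ≤ (perWin d P).card * S2 := h3
      _ ≤ (perWin d P).card * (Fintype.card n * (g * (B * K * S))) := by gcongr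
      _ = KG * g * S := by rw [hKG]; ring
  have h5 : S ≤ KG * g := by
    rcases hS0.lt_or_eq with hpos | hzero
    · rw [pow_two] at h4
      exact le_of_mul_le_mul_right h4 hpos
    · rw [← hzero, hKG]; positivity
  exact (norm_curlAt_flat_le_sum_perWin hXP z hμν).trans h5

end

end Summit.QuantumFields.BalabanUV.T4Continuum.NE7FlatSkewSliceSolvable
-- Build-lane re-trigger (t4-ne7-p2 gen 85, 2026-08-24): comment-only re-land of a82699dcffc96c23 (p379148), decls identical; never built (UNBUILT-ACCEPTED-20260824T1600 l.1330, NO-HOST).
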